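import Literature.MathematicalPhysics.QuantumFieldTheory.Balaban1983to89.T3MinimiserStabilityReduction
import Literature.MathematicalPhysics.QuantumFieldTheory.Balaban1983to89.T3PrintedRegularMinimiser
import Literature.MathematicalPhysics.QuantumFieldTheory.Balaban1983to89.T3OrbitAverage
import Literature.MathematicalPhysics.QuantumFieldTheory.Balaban1983to89.B12ContinuousTransportInvariance
import Literature.MathematicalPhysics.QuantumFieldTheory.Balaban1983to89.Node00.CanonicalTransportOfRecord
import HarnessLib

/-!
# LINE g21-1 «SUP-TAIL × CRUDE LOCALITY» — the large-field 4-point remainder LFR♯ᶜ by INTERPOLATING two controlling moduli: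
# SIZE WITHOUT LOCALITY (the window odds modulus τ_J) and LOCALITY WITHOUT SIZE (the response modulus C_J)
(ideator `ym-r3-idea-1` g21, lens «control»; crux `stmt-QuantumFields-20520` = `UnitScaleTilt.FluctuationComparisonRegPrIntL`, rung R3 = continuum SU(2) YM₃ on T³)

TARGET (concluded BY NAME, text byte-identical): the S2β organ **LFR♯ᶜ** `LargeFieldFourPtCan` of LINE g18-1 `Lines/semiclassical_s2beta.lean` (v11 §2; consumed
there by ✓`fluctuationPartSmall_of_semiclassicalCan (h3 : LargeFieldFourPtCan)`), restated VERBATIM in §0 together with everything it and the shared organs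
mention (`heightDensityCan`, `fourPt`, `fluctAtCan`, `oneLoopFourPtCan`, 1L4ᶜ `OneLoopClusteredCan`, H4ᶜ `BeyondOneLoopSmallCan`).
LFR♯ᶜ's hands so far: LFG (LINE g19-1, identity-form KP gas) and VERS ✓p752318 + PREG + LEV (LINE g20-2, per-scale TINY-AND-PINNED odds increments).
Both ask ONE estimate to deliver smallness AND pinned exponential decay AT ONCE for the log-ratio `D := log ρ − log q^{hist}` — and that coupling is the
recorded wall (census #124/#150/#161: «each term separately carries the classical response», «one polymer unclustered»).

THE LEVER (control lens — two controlling quantities with NAMED GROWTH CLASSES, knit by an interpolation inequality).  Do not estimate `Δ²D` by one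
mechanism.  Bound it TWICE, badly each time, and interpolate:
  (size)      `|Δ²_{b,b′} D| ≤ 2·τ_J`                      — TAILSUP `WindowOddsSupCan`: the OSCILLATION of `D` over the whole window is `≤ τ_J`, i.e. the conditional
                                                             probability of a bad history given a small window field `U` is `≤ 1 − e^{−τ_J}` uniformly in `U` and in the
                                                             depth; `τ_J` decays faster than every power of `J` (relative large-field factors `e^{−p₀(g_j)}` × entropy
                                                             `L^{3j}`, summed over `j > J`).  NO pinning, NO decay in `tdist(b,b′)` — a zero-order statement.
  (locality)  `|Δ²_{b,b′} D| ≤ (C_J + φ₁ J + φ₂ J)·e^{−κ d}` — CRUDELOC `CrudeLocalityCan`: the FULL fluctuation part `log ρ + β_K·𝔄^reg` (S2β's own integrand) has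
                                                             κ-clustered 4-points with a modulus `C_J` of at most POLYNOMIAL growth in `J` (the classical response
                                                             `β_Jθ_J² ≍ p(g_J)²` is ALLOWED — no semiclassical cancellation, no (45)–(47)), minus the small-history
                                                             fluctuation part, whose 4-points are `≤ (φ₁+φ₂)e^{−κd}` by the SHARED organs 1L4ᶜ + H4ᶜ.  NO smallness.
  (knit, PROVED §3)  `|Δ²D| ≤ min(x, y) ≤ √(x·y) = √(2(C_J+φ₁J+φ₂J)τ_J) · e^{−κd/2}`  and  `J·√(2(C_J+φ₁+φ₂)τ_J) → 0`
                     because polynomial × super-polynomial → 0 (`J²C_Jτ_J ≤ C₀(J+1)^{a+2}τ_J → 0`, `(Jφᵢ)(Jτ_J) → 0·0`).  Half the rate, the geometric mean of the sizes.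
So LFR♯ᶜ ⟸ 1L4ᶜ ∧ H4ᶜ ∧ TAILSUP ∧ CRUDELOC (✓`largeFieldFourPtCan_of_split`), and in the lane's DAG S2β ⟸ {EXW, GAP♯, DET-REP-B, H4ᶜ} ∪ {TAILSUP, CRUDELOC}:
the organ LFR♯ᶜ is DISSOLVED into a sup-norm tail row (L) and a crude-locality row (XL) that never has to be small.

WHY EASIER / WHY NEW (problem-relative).  LEV (g20-2) and LFG (g19-1) need, inside ONE estimate, Peierls tail × entropy × MIXING (covariance decay of the
conditional fluctuation measure THROUGH large-field regions) — the mixing-with-large-fields is the unlocated XL content of both (LOCATE-LFG §2; PREG∕LEV notes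
px16 g12 00:13:50Z, px19 g11 00:12:27Z).  Here the tail row TAILSUP carries NO mixing (it is a bound on a conditional probability, uniform in the condition),
and the locality row CRUDELOC carries NO tail and NO smallness: it is the statement that Bałaban's effective densities are sums of terms localized in domains
with tree decay ([Balaban1989LargeFieldII] (1.66)–(1.67) p.376; [Balaban1988Convergent] §2–3) read with CRUDE constants — strictly weaker than S2β (S2β ⇒ CRUDELOC PROVED in §1, ✓`crudeLocality_of_fluctuationPartSmall`;
CRUDELOC ⇏ S2β, ⇏ LFR♯ᶜ).  The interpolation `min ≤ √(·,·)` is the one move none of the listed lines (LFG, LEV, REP, DIFF+FMIX, EXTRACT†,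
relative-entropy†) makes: they all estimate the difference; this line never does — it estimates the two laws' fluctuation parts SEPARATELY (allowed to be
large, census #161's objection becomes the hypothesis) and gets smallness from the zero-order odds.  Honest residue: CRUDELOC is XL (uniform-in-depth
quasi-locality of the full effective action = the localization half of the R∕T-operation bookkeeping, incl. large fine fields); TAILSUP is L (fibrewise =
conditional large-field suppression, stronger than the integrated tails of crux 26243 ∕ S1b and not implied by them).  First rung for hands: `WindowOddsSupDepthOneCan`
(TAILSUP on the runs `K = J + 1`: ONE free level — the one-step constrained fluctuation measure's conditional odds of a large fine plaquette; ✓`windowOddsSupDepthOne_of`).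

Sorries = {1L4ᶜ `stub_oneLoopClusteredCan` (SHARED, g18-1: ⟸ EXW, GAP♯, DET-REP-B by ✓`oneLoopClusteredCan_of_organs`), H4ᶜ `stub_beyondOneLoopSmallCan` (SHARED),
TAILSUP `stub_windowOddsSupCan` (NEW, L), CRUDELOC `stub_crudeLocalityCan` (NEW, XL)}; 0 elsewhere.  PUBLISHED organ-level line (RULING №36 (3)): NOT registered
as the crux item's skeleton.  No summit is proved by a line; `YM3TorusSU2` is NOT proved (S1a, 26243, S2α′, O1 and S2β's organs EXW, GAP♯, DET-REP-B, H4ᶜ stay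
open); `FluctuationComparisonRegPrIntL` (20520) is NOT concluded by name by this file; nothing of Bałaban's asserted; rung R3 (YM₃ on T³) — NOT d = 4, NOT
infinite volume, NOT a mass gap, NOT Clay.
-/

noncomputable section

open MeasureTheory Filter Topology Set
open Literature.MathematicalPhysics.QuantumFieldTheory.Balaban1983to89
open Literature.MathematicalPhysics.QuantumFieldTheory.Balaban1983to89.T3ContinuumYM3Torus
open Literature.MathematicalPhysics.QuantumFieldTheory.Balaban1983to89.T3NestedUnitLaws
open Literature.MathematicalPhysics.QuantumFieldTheory.Balaban1983to89.T3UnitLawDensityEML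
open Literature.MathematicalPhysics.QuantumFieldTheory.Balaban1983to89.T3UnitScaleTilt
open Literature.MathematicalPhysics.QuantumFieldTheory.Balaban1983to89.T3TiltDescent
open Literature.MathematicalPhysics.QuantumFieldTheory.Balaban1983to89.T3PrintedRegularMinimiser
open Literature.MathematicalPhysics.QuantumFieldTheory.Balaban1983to89.T3ConstrainedMinimiser (fibre)
open Literature.MathematicalPhysics.QuantumFieldTheory.Balaban1983to89.T3LevelShift
open Literature.MathematicalPhysics.QuantumFieldTheory.Balaban1983to89.Missing
open Literature.MathematicalPhysics.QuantumFieldTheory.Balaban1983to89.T4Continuum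

namespace Summit.QuantumFields.YangMills.Cruxes.FluctuationComparisonRegPrIntL.RunPairOrgan.SupTailSplit

/-! ## §0a The canonical version of the restricted height density (verbatim from LINE g18-1 v11 §1) -/

section Canonical

variable (F : T3Family) (γ : ℝ) {J K : ℕ} (hJK : J ≤ K) (S : Set (GaugeField (F.P K) 0 (Matrix.specialUnitaryGroup (Fin 2) ℂ)))

/-- **THE CANONICAL VERSION OF BAŁABAN'S RESTRICTED DENSITY AT HEIGHT `K − J`** read on the `J`-th tower's finest lattice: the trunk's `heightDensity`
(a chosen Radon–Nikodym version) replaced by `Node00.canonVersion` of its a.e.-class for product Haar — continuous on the maximal open set carrying a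
continuous representative and equal there to every such representative. [cite: Balaban1985UV3, (2) p.256 and (41) p.266] -/
def heightDensityCan (V : GaugeField (F.P J) 0 (Matrix.specialUnitaryGroup (Fin 2) ℂ)) : ℝ :=
  Node00.canonVersion (fieldMeasure (F.P J) 0 (Matrix.specialUnitaryGroup (Fin 2) ℂ)) (heightDensity F γ hJK S) V


end Canonical

/-! ## §0b The connected 4-point, the λ-scaled fluctuation part, the SHARED organs 1L4ᶜ ∕ H4ᶜ and the TARGET organ LFR♯ᶜ (verbatim from LINE g18-1 v11 §2) -/

section Rows

/-- The connected 4-point (mixed second difference) — verbatim from v3a. [cite: Balaban1985UV3, (41) p.266] -/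
def fourPt {X : Type*} (f : X → ℝ) (U V W Z : X) : ℝ := (f U - f V) - (f W - f Z)

variable (F : T3Family) (γ b₀ p₀ ε₀ : ℝ) {J K : ℕ} (hJK : J ≤ K)

/-- **THE λ-SCALED FLUCTUATION PART OVER THE CANONICAL VERSION** `f^λ(V) := log heightDensityCan F (γ/λ) (histGood at θBal(γ)) V + β_K(γ/λ)·minActionRegPr(V)`.
[cite: Balaban1985UV3, (2) p.256 and (41) p.266] -/
def fluctAtCan (lam : ℝ) (V : GaugeField (F.P J) 0 (Matrix.specialUnitaryGroup (Fin 2) ℂ)) : ℝ :=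
  Real.log (heightDensityCan F (γ / lam) hJK (histGood F ℰp (θBal F.L γ b₀ p₀) K J) V)
    + (F.scheme ℰp (γ / lam)).β K * minActionRegPr F J K hJK ε₀ V

/-- **THE CANONICAL ONE-LOOP 4-POINT** `Λ₄ := lim_{λ→∞} Δ² f^λ` over the canonical version (junk if the limit does not exist; 1L4ᶜ asserts it does).
[cite: Balaban1985Variational, Thm 1 (8)-(10) p.279] -/
def oneLoopFourPtCan (U V W Z : GaugeField (F.P J) 0 (Matrix.specialUnitaryGroup (Fin 2) ℂ)) : ℝ :=
  limUnder atTop (fun lam : ℝ => fourPt (fluctAtCan F γ b₀ p₀ ε₀ hJK lam) U V W Z)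

/-- At `λ = 1`: S2β's integrand with the canonical small-history density. [cite: Balaban1985UV3, (41) p.266] -/
theorem fluctAtCan_one (V : GaugeField (F.P J) 0 (Matrix.specialUnitaryGroup (Fin 2) ℂ)) :
    fluctAtCan F γ b₀ p₀ ε₀ hJK 1 V =
      Real.log (heightDensityCan F γ hJK (histGood F ℰp (θBal F.L γ b₀ p₀) K J) V)
        + (F.scheme ℰp γ).β K * minActionRegPr F J K hJK ε₀ V := by
  simp only [fluctAtCan, div_one]

/-- Whenever the λ-scaled 4-point has SOME limit `a`, the canonical one-loop 4-point equals it. [cite: Balaban1985Variational, Thm 1 (8) p.279] -/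
theorem oneLoopFourPtCan_eq_of_tendsto (U V W Z : GaugeField (F.P J) 0 (Matrix.specialUnitaryGroup (Fin 2) ℂ)) {a : ℝ}
    (h : Tendsto (fun lam : ℝ => fourPt (fluctAtCan F γ b₀ p₀ ε₀ hJK lam) U V W Z) atTop (𝓝 a)) :
    oneLoopFourPtCan F γ b₀ p₀ ε₀ hJK U V W Z = a := by
  unfold oneLoopFourPtCan; exact h.limUnder_eq

/-- **1L4ᶜ · ONE-LOOP 4-POINTS EXIST AND ARE CLUSTERED, OVER THE CANONICAL VERSION** (re-typing of v3a's `OneLoopClustered`): same prefix; for every run `K`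
and height `J ≤ K`: **(R)** for every `λ ≥ 1` the window lies in the maximal regular open set of the restricted density at coupling `γ/λ` (the small-field
fibre density HAS a continuous version on the window — coarea form of the push-forward, fibrewise nullity of the threshold level sets, [Balaban1985Averaging]
(10)); **(P)** the canonical version is positive on the window for every `λ ≥ 1`; **(T)** at every window quadrilateral the semiclassical limit of the 4-point of
`f^λ` exists and is κ-clustered of size `≤ φ₁ J`, `J·φ₁ J → 0`, depth-uniform.  Mechanism and risks as in v3a's 1L4, PLUS the honest analytic content of (R).
[cite: Balaban1985Variational, Thm 1 (8)-(10) p.279; Balaban1985Averaging, (10) p.19] -/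
def OneLoopClusteredCan : Prop :=
  ∀ (L : ℕ), ∃ pS : ℝ, ∀ (b₀ p₀ : ℝ), 0 < b₀ → pS ≤ p₀ → 0 < p₀ → ∃ ε₁ : ℝ, 0 < ε₁ ∧ ∀ (ε₀ : ℝ), 0 < ε₀ → ε₀ ≤ ε₁ →
    ∃ γ₁ : ℝ, 0 < γ₁ ∧ ∃ κ : ℝ, 0 < κ ∧ ∀ (F : T3Family) (γ : ℝ), F.L = L → 0 < γ → γ ≤ γ₁ →
      ∃ φ₁ : ℕ → ℝ, (∀ J, 0 ≤ φ₁ J) ∧ Tendsto (fun J : ℕ => (J : ℝ) * φ₁ J) atTop (𝓝 0) ∧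
        ∀ (J K : ℕ) (hJK : J ≤ K),
          (∀ lam : ℝ, 1 ≤ lam →
            {U : GaugeField (F.P J) 0 (Matrix.specialUnitaryGroup (Fin 2) ℂ) | PlaqSmall (θBal F.L γ b₀ p₀ J) U} ⊆
              Node00.regSet (fieldMeasure (F.P J) 0 (Matrix.specialUnitaryGroup (Fin 2) ℂ))
                (heightDensity F (γ / lam) hJK (histGood F ℰp (θBal F.L γ b₀ p₀) K J))) ∧
          (∀ lam : ℝ, 1 ≤ lam → ∀ U : GaugeField (F.P J) 0 (Matrix.specialUnitaryGroup (Fin 2) ℂ), PlaqSmall (θBal F.L γ b₀ p₀ J) U →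
              0 < heightDensityCan F (γ / lam) hJK (histGood F ℰp (θBal F.L γ b₀ p₀) K J) U) ∧
          ∀ (b b' : PBond (F.P J) 0) (U V W Z : GaugeField (F.P J) 0 (Matrix.specialUnitaryGroup (Fin 2) ℂ)),
            PlaqSmall (θBal F.L γ b₀ p₀ J) U → PlaqSmall (θBal F.L γ b₀ p₀ J) V →
            PlaqSmall (θBal F.L γ b₀ p₀ J) W → PlaqSmall (θBal F.L γ b₀ p₀ J) Z →
            (∀ e, e ≠ b → U e = V e) → (∀ e, e ≠ b' → U e = W e) → (∀ e, e ≠ b' → V e = Z e) → (∀ e, e ≠ b → W e = Z e) →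
            Tendsto (fun lam : ℝ => fourPt (fluctAtCan F γ b₀ p₀ ε₀ hJK lam) U V W Z) atTop
                (𝓝 (oneLoopFourPtCan F γ b₀ p₀ ε₀ hJK U V W Z)) ∧
              |oneLoopFourPtCan F γ b₀ p₀ ε₀ hJK U V W Z| ≤ φ₁ J * Real.exp (-(κ * (b.src.tdist b'.src : ℝ)))

/-- **H4ᶜ · BEYOND ONE LOOP, OVER THE CANONICAL VERSION** (re-typing of v3a's `BeyondOneLoopSmall`): the `λ = 1` connected 4-point of `f^λ` differs from its
semiclassical limit by a κ-clustered `≤ φ₂ J`, `J·φ₂ J → 0`, depth-uniform. [cite: Balaban1985UV3, (45)-(47) p.267; Balaban1987RG1, Thm 1 (0.19)-(0.26)] -/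
def BeyondOneLoopSmallCan : Prop :=
  ∀ (L : ℕ), ∃ pS : ℝ, ∀ (b₀ p₀ : ℝ), 0 < b₀ → pS ≤ p₀ → 0 < p₀ → ∃ ε₁ : ℝ, 0 < ε₁ ∧ ∀ (ε₀ : ℝ), 0 < ε₀ → ε₀ ≤ ε₁ →
    ∃ γ₁ : ℝ, 0 < γ₁ ∧ ∃ κ : ℝ, 0 < κ ∧ ∀ (F : T3Family) (γ : ℝ), F.L = L → 0 < γ → γ ≤ γ₁ →
      ∃ φ₂ : ℕ → ℝ, (∀ J, 0 ≤ φ₂ J) ∧ Tendsto (fun J : ℕ => (J : ℝ) * φ₂ J) atTop (𝓝 0) ∧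
        ∀ (J K : ℕ) (hJK : J ≤ K) (b b' : PBond (F.P J) 0) (U V W Z : GaugeField (F.P J) 0 (Matrix.specialUnitaryGroup (Fin 2) ℂ)),
          PlaqSmall (θBal F.L γ b₀ p₀ J) U → PlaqSmall (θBal F.L γ b₀ p₀ J) V →
          PlaqSmall (θBal F.L γ b₀ p₀ J) W → PlaqSmall (θBal F.L γ b₀ p₀ J) Z →
          (∀ e, e ≠ b → U e = V e) → (∀ e, e ≠ b' → U e = W e) → (∀ e, e ≠ b' → V e = Z e) → (∀ e, e ≠ b → W e = Z e) →
          |fourPt (fluctAtCan F γ b₀ p₀ ε₀ hJK 1) U V W Z - oneLoopFourPtCan F γ b₀ p₀ ε₀ hJK U V W Z|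
            ≤ φ₂ J * Real.exp (-(κ * (b.src.tdist b'.src : ℝ)))

/-- **LFR♯ᶜ · LARGE-FIELD 4-POINT REMAINDER, OVER THE CANONICAL VERSION** (re-typing of v3a's `LargeFieldFourPt`): for every continuous positive window version
`ρ` of the full nested law, `log ρ − log heightDensityCan^{histGood}` has κ-clustered connected 4-points `≤ ψ J`, `J·ψ J → 0`, depth-uniform, given positivity
of the canonical small-history density on the window. [cite: Balaban1988Convergent, §2 (2.18)-(2.27); Balaban1989LargeFieldI, §1] -/
def LargeFieldFourPtCan : Prop :=
  ∀ (L : ℕ), ∃ pS : ℝ, ∀ (b₀ p₀ : ℝ), 0 < b₀ → pS ≤ p₀ → 0 < p₀ →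
    ∃ γ₁ : ℝ, 0 < γ₁ ∧ ∃ κ : ℝ, 0 < κ ∧ ∀ (F : T3Family) (γ : ℝ), F.L = L → 0 < γ → γ ≤ γ₁ →
      ∃ ψ : ℕ → ℝ, (∀ J, 0 ≤ ψ J) ∧ Tendsto (fun J : ℕ => (J : ℝ) * ψ J) atTop (𝓝 0) ∧
        ∀ (ν : ℕ → (j : ℕ) → Measure (GaugeField (F.P j) 0 (Matrix.specialUnitaryGroup (Fin 2) ℂ))),
          (∀ K, ν K K = T4GenFunBounds.gibbsMeasure (F.P K) ((F.scheme ℰp γ).β K)) →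
          (∀ K j, j < K → ν K j = Measure.map (descend F ℰp j) (ν K (j + 1))) →
          ∀ (J K : ℕ) (hJK : J ≤ K) (ρ : GaugeField (F.P J) 0 (Matrix.specialUnitaryGroup (Fin 2) ℂ) → ℝ),
            (∀ U, PlaqSmall (θBal F.L γ b₀ p₀ J) U → 0 < ρ U) →
            ν K J = (fieldMeasure _ _ _).withDensity (fun U => ENNReal.ofReal (ρ U)) →
            ContinuousOn ρ {U | PlaqSmall (θBal F.L γ b₀ p₀ J) U} →
            (∀ U : GaugeField (F.P J) 0 (Matrix.specialUnitaryGroup (Fin 2) ℂ), PlaqSmall (θBal F.L γ b₀ p₀ J) U →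
                0 < heightDensityCan F γ hJK (histGood F ℰp (θBal F.L γ b₀ p₀) K J) U) →
            ∀ (b b' : PBond (F.P J) 0) (U V W Z : GaugeField (F.P J) 0 (Matrix.specialUnitaryGroup (Fin 2) ℂ)),
              PlaqSmall (θBal F.L γ b₀ p₀ J) U → PlaqSmall (θBal F.L γ b₀ p₀ J) V →
              PlaqSmall (θBal F.L γ b₀ p₀ J) W → PlaqSmall (θBal F.L γ b₀ p₀ J) Z →
              (∀ e, e ≠ b → U e = V e) → (∀ e, e ≠ b' → U e = W e) → (∀ e, e ≠ b' → V e = Z e) → (∀ e, e ≠ b → W e = Z e) →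
              |fourPt (fun U => Real.log (ρ U) - Real.log (heightDensityCan F γ hJK (histGood F ℰp (θBal F.L γ b₀ p₀) K J) U)) U V W Z|
                ≤ ψ J * Real.exp (-(κ * (b.src.tdist b'.src : ℝ)))

/-! ## §1 The two NEW rows: TAILSUP (size without locality) and CRUDELOC (locality without size) -/

/-- **TAILSUP · FIBREWISE HISTORY ODDS ARE SUPER-POLYNOMIALLY CLOSE TO EVEN, UNIFORMLY ON THE WINDOW** (`WindowOddsSupCan`; size L; NEW in this line).
LFR♯ᶜ's prefix without `κ`; for every block size, profile and coupling there is a modulus `τ : ℕ → ℝ`, `τ ≥ 0`, decaying faster than every power of the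
height (`(J+1)^a·τ J → 0` for every `a : ℕ`), such that for every run `K`, height `J ≤ K` and every continuous positive window version `ρ` of the nested law
`ν_{K,J}`, given positivity of the canonical small-history density on the window, the log-ratio `log ρ − log heightDensityCan^{histGood}` has OSCILLATION
`≤ τ J` over the whole window: `∃ c, ∀ U ∈ window, 0 ≤ log ρ U − c − log q^{hist} U ≤ τ J`.  Reading: `c = −log Z_K` (VERS ✓`…OddsLedgerVers.fullVersionConstCan`:
on the window `ρ = Z_K⁻¹·heightDensityCan^{univ}`), `log ρ − c − log q^{hist} = −log P(history good ∣ V_J = U) ≥ 0`, so the row says: the CONDITIONAL probability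
of a bad history given a small window field is `≤ 1 − e^{−τ_J}` UNIFORMLY in the window field and in the depth `K − J` — a zero-order (sup-norm) statement with
NO pinning and NO decay.  Print's mechanism: relative large-field factors `exp(−p₀(g_j))` per large plaquette ([Balaban1989LargeFieldII] (1.77)–(1.79) p.383,
(1.95) p.389; [Balaban1985UV3] (38)–(40) p.266: Gaussian large deviation of the constrained fluctuation field, positivity of the fluctuation operator) against
the entropy `L^{3j}` of level-`j` plaquettes, summed over the free levels `j > J`: convergent and `≍ L^{(3+N)J}e^{−c b₀²(J log L)^{2p₀}}`, super-polynomially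
small in `J` once `2p₀ > 1` (`pS`).  WHY IT MIGHT FAIL: a FIBREWISE (conditional on `V_J = U`, pointwise in `U`) bound is stronger than the integrated tails
✓`FirstExitWindowTailL`-type (crux 26243, S1b `RunWindowTailsL`) and is not implied by them; uniformity up to the window's edge `|F_p(U)| ≈ θ_J` needs the
interpolating fine fields to stay deep inside the finer windows (`θ_{J+1} ≍ L^{-1/2}θ_J ≫ L^{-2}θ_J`, true for Bałaban's profile, to be checked on the tree's
`θBal`).  First rung: `WindowOddsSupDepthOneCan` (runs `K = J+1`).
[cite: Balaban1989LargeFieldII, (1.77)-(1.79) p.383 and (1.95) p.389; Balaban1985UV3, (38)-(40) p.266; Balaban1988Convergent, §2 (2.18)-(2.27)] -/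
def WindowOddsSupCan : Prop :=
  ∀ (L : ℕ), ∃ pS : ℝ, ∀ (b₀ p₀ : ℝ), 0 < b₀ → pS ≤ p₀ → 0 < p₀ →
    ∃ γ₁ : ℝ, 0 < γ₁ ∧ ∀ (F : T3Family) (γ : ℝ), F.L = L → 0 < γ → γ ≤ γ₁ →
      ∃ τ : ℕ → ℝ, (∀ J, 0 ≤ τ J) ∧ (∀ a : ℕ, Tendsto (fun J : ℕ => ((J : ℝ) + 1) ^ a * τ J) atTop (𝓝 0)) ∧
        ∀ (ν : ℕ → (j : ℕ) → Measure (GaugeField (F.P j) 0 (Matrix.specialUnitaryGroup (Fin 2) ℂ))),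
          (∀ K, ν K K = T4GenFunBounds.gibbsMeasure (F.P K) ((F.scheme ℰp γ).β K)) →
          (∀ K j, j < K → ν K j = Measure.map (descend F ℰp j) (ν K (j + 1))) →
          ∀ (J K : ℕ) (hJK : J ≤ K) (ρ : GaugeField (F.P J) 0 (Matrix.specialUnitaryGroup (Fin 2) ℂ) → ℝ),
            (∀ U, PlaqSmall (θBal F.L γ b₀ p₀ J) U → 0 < ρ U) →
            ν K J = (fieldMeasure _ _ _).withDensity (fun U => ENNReal.ofReal (ρ U)) →
            ContinuousOn ρ {U | PlaqSmall (θBal F.L γ b₀ p₀ J) U} →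
            (∀ U : GaugeField (F.P J) 0 (Matrix.specialUnitaryGroup (Fin 2) ℂ), PlaqSmall (θBal F.L γ b₀ p₀ J) U →
                0 < heightDensityCan F γ hJK (histGood F ℰp (θBal F.L γ b₀ p₀) K J) U) →
            ∃ c : ℝ, ∀ U : GaugeField (F.P J) 0 (Matrix.specialUnitaryGroup (Fin 2) ℂ), PlaqSmall (θBal F.L γ b₀ p₀ J) U →
              0 ≤ Real.log (ρ U) - c - Real.log (heightDensityCan F γ hJK (histGood F ℰp (θBal F.L γ b₀ p₀) K J) U) ∧
              Real.log (ρ U) - c - Real.log (heightDensityCan F γ hJK (histGood F ℰp (θBal F.L γ b₀ p₀) K J) U) ≤ τ J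

/-- **TAILSUP₁ · THE FIRST RUNG** (`WindowOddsSupDepthOneCan`): TAILSUP on the runs `K = J + 1` only — ONE free level above the window, so the bad
history is «some run-`(J+1)` plaquette is large» and the conditional measure given `V_J = U` is the ONE-STEP constrained fluctuation measure of the tree
(`T3ConstrainedMinimiser.fibre`, the one-step chart∕Laplace tools of ✓WREG, KPL-E ✓p746335): a Gaussian-tail × one-level-entropy estimate, no multi-scale
bookkeeping.  PROVED below from TAILSUP (✓`windowOddsSupDepthOne_of`); stated for the hands as the entry point.
[cite: Balaban1985UV3, (38)-(40) p.266; Balaban1985Averaging, (10) p.19] -/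
def WindowOddsSupDepthOneCan : Prop :=
  ∀ (L : ℕ), ∃ pS : ℝ, ∀ (b₀ p₀ : ℝ), 0 < b₀ → pS ≤ p₀ → 0 < p₀ →
    ∃ γ₁ : ℝ, 0 < γ₁ ∧ ∀ (F : T3Family) (γ : ℝ), F.L = L → 0 < γ → γ ≤ γ₁ →
      ∃ τ : ℕ → ℝ, (∀ J, 0 ≤ τ J) ∧ (∀ a : ℕ, Tendsto (fun J : ℕ => ((J : ℝ) + 1) ^ a * τ J) atTop (𝓝 0)) ∧
        ∀ (ν : ℕ → (j : ℕ) → Measure (GaugeField (F.P j) 0 (Matrix.specialUnitaryGroup (Fin 2) ℂ))),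
          (∀ K, ν K K = T4GenFunBounds.gibbsMeasure (F.P K) ((F.scheme ℰp γ).β K)) →
          (∀ K j, j < K → ν K j = Measure.map (descend F ℰp j) (ν K (j + 1))) →
          ∀ (J : ℕ) (ρ : GaugeField (F.P J) 0 (Matrix.specialUnitaryGroup (Fin 2) ℂ) → ℝ),
            (∀ U, PlaqSmall (θBal F.L γ b₀ p₀ J) U → 0 < ρ U) →
            ν (J + 1) J = (fieldMeasure _ _ _).withDensity (fun U => ENNReal.ofReal (ρ U)) →
            ContinuousOn ρ {U | PlaqSmall (θBal F.L γ b₀ p₀ J) U} →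
            (∀ U : GaugeField (F.P J) 0 (Matrix.specialUnitaryGroup (Fin 2) ℂ), PlaqSmall (θBal F.L γ b₀ p₀ J) U →
                0 < heightDensityCan F γ (Nat.le_succ J) (histGood F ℰp (θBal F.L γ b₀ p₀) (J + 1) J) U) →
            ∃ c : ℝ, ∀ U : GaugeField (F.P J) 0 (Matrix.specialUnitaryGroup (Fin 2) ℂ), PlaqSmall (θBal F.L γ b₀ p₀ J) U →
              0 ≤ Real.log (ρ U) - c - Real.log (heightDensityCan F γ (Nat.le_succ J) (histGood F ℰp (θBal F.L γ b₀ p₀) (J + 1) J) U) ∧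
              Real.log (ρ U) - c - Real.log (heightDensityCan F γ (Nat.le_succ J) (histGood F ℰp (θBal F.L γ b₀ p₀) (J + 1) J) U) ≤ τ J

/-- TAILSUP ⇒ TAILSUP₁ (specialisation to `K = J + 1`). [folklore] -/
theorem windowOddsSupDepthOne_of (h : WindowOddsSupCan) : WindowOddsSupDepthOneCan := by
  intro L
  obtain ⟨pS, H⟩ := h L
  refine ⟨pS, fun b₀ p₀ hb hpS hp => ?_⟩
  obtain ⟨γ₁, hγ₁, H⟩ := H b₀ p₀ hb hpS hp
  refine ⟨γ₁, hγ₁, fun F γ hFL hγ hγle => ?_⟩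
  obtain ⟨τ, hτ0, hτa, H⟩ := H F γ hFL hγ hγle
  exact ⟨τ, hτ0, hτa, fun ν hνK hνd J ρ hρpos hνρ hρcont hgpos => H ν hνK hνd J (J + 1) (Nat.le_succ J) ρ hρpos hνρ hρcont hgpos⟩

/-- **CRUDELOC · THE FULL FLUCTUATION PART IS QUASI-LOCAL WITH A POLYNOMIAL RESPONSE MODULUS** (`CrudeLocalityCan`; size XL; NEW in this line; this line's
organ).  S2β `FluctuationPartSmall` VERBATIM except that its modulus clause `(∀ J, 0 ≤ φ J) ∧ J·φ J → 0` is REPLACED by `(∀ J, 0 ≤ C J) ∧ ∃ a C₀, ∀ J, C J ≤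
C₀·(J+1)^a`: for every continuous positive window version `ρ` of `ν_{K,J}` the integrand `log ρ + β_K·𝔄^reg_{J,K,ε₀}` has κ-clustered connected 4-points of size
`≤ C J`, AT MOST POLYNOMIAL in the height, uniformly in the depth.  The classical response `β_Jθ_J² ≍ p(g_J)² ≍ b₀²(J log L)^{2p₀}` — the term that kills every
«estimate the two laws separately» attempt at S2β's precision (census #161) — is ALLOWED here; no semiclassical expansion, no (45)–(47) cancellation, no
determinant asymptotics: only that Bałaban's effective densities (ALL histories, large fine fields included) are sums of terms localized in domains with tree
decay `e^{−κ d(X)}` and polynomially bounded activities ([Balaban1989LargeFieldII] (1.66)–(1.67) p.376, Thm p.389 (1.95); [Balaban1988Convergent] §2 (2.18)–(2.27),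
§3), plus the exponential locality of the regular minimiser's response (landed B11∕[Balaban1984PropagatorsI]).  S2β ⇒ CRUDELOC (a convergent `J·φ J → 0` is bounded:
`a = 0`); CRUDELOC ⇏ S2β, ⇏ LFR♯ᶜ.  WHY IT MIGHT FAIL: uniform-in-`K` exponential clustering of the FULL density's 4-points through large-field regions of the
fine levels is the localization half of the R∕T-operation induction — XL, in print only inside the whole inductive scheme; a hand may find that crude constants
do not decouple from the inductive smallness (the resummations (1.66)→(1.68) use `p₀(g_k)` largeness to control combinatorial factors).
[cite: Balaban1989LargeFieldII, (1.66)-(1.67) p.376 and (1.95) p.389; Balaban1988Convergent, §2 (2.18)-(2.27); Balaban1985UV3, Thm 2 p.263 and (41) p.266; Balaban1984PropagatorsI, Thm 1] -/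
def CrudeLocalityCan : Prop :=
  ∀ (L : ℕ), ∃ pS : ℝ, ∀ (b₀ p₀ : ℝ), 0 < b₀ → pS ≤ p₀ → 0 < p₀ → ∃ ε₁ : ℝ, 0 < ε₁ ∧ ∀ (ε₀ : ℝ), 0 < ε₀ → ε₀ ≤ ε₁ →
    ∃ γ₁ : ℝ, 0 < γ₁ ∧ ∃ κ : ℝ, 0 < κ ∧ ∀ (F : T3Family) (γ : ℝ), F.L = L → 0 < γ → γ ≤ γ₁ →
      ∃ (C : ℕ → ℝ), (∀ J, 0 ≤ C J) ∧ (∃ (a : ℕ) (C₀ : ℝ), ∀ J, C J ≤ C₀ * ((J : ℝ) + 1) ^ a) ∧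
        ∀ (ν : ℕ → (j : ℕ) → Measure (GaugeField (F.P j) 0 (Matrix.specialUnitaryGroup (Fin 2) ℂ))),
          (∀ K, ν K K = T4GenFunBounds.gibbsMeasure (F.P K) ((F.scheme ℰp γ).β K)) →
          (∀ K j, j < K → ν K j = Measure.map (descend F ℰp j) (ν K (j + 1))) →
          ∀ (J K : ℕ) (hJK : J ≤ K) (ρ : GaugeField (F.P J) 0 (Matrix.specialUnitaryGroup (Fin 2) ℂ) → ℝ),
            (∀ U, PlaqSmall (θBal F.L γ b₀ p₀ J) U → 0 < ρ U) →
            ν K J = (fieldMeasure _ _ _).withDensity (fun U => ENNReal.ofReal (ρ U)) →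
            ContinuousOn ρ {U | PlaqSmall (θBal F.L γ b₀ p₀ J) U} →
            ∀ (b b' : PBond (F.P J) 0) (U V W Z : GaugeField (F.P J) 0 (Matrix.specialUnitaryGroup (Fin 2) ℂ)),
              PlaqSmall (θBal F.L γ b₀ p₀ J) U → PlaqSmall (θBal F.L γ b₀ p₀ J) V →
              PlaqSmall (θBal F.L γ b₀ p₀ J) W → PlaqSmall (θBal F.L γ b₀ p₀ J) Z →
              (∀ e, e ≠ b → U e = V e) → (∀ e, e ≠ b' → U e = W e) → (∀ e, e ≠ b' → V e = Z e) → (∀ e, e ≠ b → W e = Z e) →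
              |((Real.log (ρ U) + (F.scheme ℰp γ).β K * minActionRegPr F J K hJK ε₀ U)
                  - (Real.log (ρ V) + (F.scheme ℰp γ).β K * minActionRegPr F J K hJK ε₀ V))
                - ((Real.log (ρ W) + (F.scheme ℰp γ).β K * minActionRegPr F J K hJK ε₀ W)
                  - (Real.log (ρ Z) + (F.scheme ℰp γ).β K * minActionRegPr F J K hJK ε₀ Z))|
                ≤ C J * Real.exp (-(κ * (b.src.tdist b'.src : ℝ)))

/-- **S2β · FLUCTUATION PART SMALL IN 4-POINT CURRENCY** — VERBATIM from the package `Lines/runpair_organ.lean` v15 / skeleton v3a (version-free: it quantifies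
over continuous positive versions `ρ`). [cite: Balaban1985UV3, Thm 2 p.263 and (41) p.266] -/
def FluctuationPartSmall : Prop :=
  ∀ (L : ℕ), ∃ pS : ℝ, ∀ (b₀ p₀ : ℝ), 0 < b₀ → pS ≤ p₀ → 0 < p₀ → ∃ ε₁ : ℝ, 0 < ε₁ ∧ ∀ (ε₀ : ℝ), 0 < ε₀ → ε₀ ≤ ε₁ →
    ∃ γ₁ : ℝ, 0 < γ₁ ∧ ∃ κ : ℝ, 0 < κ ∧ ∀ (F : T3Family) (γ : ℝ), F.L = L → 0 < γ → γ ≤ γ₁ →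
      ∃ (φ : ℕ → ℝ), (∀ J, 0 ≤ φ J) ∧ Tendsto (fun J : ℕ => (J : ℝ) * φ J) atTop (𝓝 0) ∧
        ∀ (ν : ℕ → (j : ℕ) → Measure (GaugeField (F.P j) 0 (Matrix.specialUnitaryGroup (Fin 2) ℂ))),
          (∀ K, ν K K = T4GenFunBounds.gibbsMeasure (F.P K) ((F.scheme ℰp γ).β K)) →
          (∀ K j, j < K → ν K j = Measure.map (descend F ℰp j) (ν K (j + 1))) →
          ∀ (J K : ℕ) (hJK : J ≤ K) (ρ : GaugeField (F.P J) 0 (Matrix.specialUnitaryGroup (Fin 2) ℂ) → ℝ),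
            (∀ U, PlaqSmall (θBal F.L γ b₀ p₀ J) U → 0 < ρ U) →
            ν K J = (fieldMeasure _ _ _).withDensity (fun U => ENNReal.ofReal (ρ U)) →
            ContinuousOn ρ {U | PlaqSmall (θBal F.L γ b₀ p₀ J) U} →
            ∀ (b b' : PBond (F.P J) 0) (U V W Z : GaugeField (F.P J) 0 (Matrix.specialUnitaryGroup (Fin 2) ℂ)),
              PlaqSmall (θBal F.L γ b₀ p₀ J) U → PlaqSmall (θBal F.L γ b₀ p₀ J) V →
              PlaqSmall (θBal F.L γ b₀ p₀ J) W → PlaqSmall (θBal F.L γ b₀ p₀ J) Z →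
              (∀ e, e ≠ b → U e = V e) → (∀ e, e ≠ b' → U e = W e) → (∀ e, e ≠ b' → V e = Z e) → (∀ e, e ≠ b → W e = Z e) →
              |((Real.log (ρ U) + (F.scheme ℰp γ).β K * minActionRegPr F J K hJK ε₀ U)
                  - (Real.log (ρ V) + (F.scheme ℰp γ).β K * minActionRegPr F J K hJK ε₀ V))
                - ((Real.log (ρ W) + (F.scheme ℰp γ).β K * minActionRegPr F J K hJK ε₀ W)
                  - (Real.log (ρ Z) + (F.scheme ℰp γ).β K * minActionRegPr F J K hJK ε₀ Z))|
                ≤ φ J * Real.exp (-(κ * (b.src.tdist b'.src : ℝ)))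


/-- **S2β ⇒ CRUDELOC (PROVED)** — the crude-locality row is a CONSEQUENCE of the organ it serves (it is used toward S2β through LFR♯ᶜ, never instead of it):
a modulus with `J·φ J → 0` is bounded, hence of polynomial growth with exponent `0`.  Recorded so that no reader mistakes CRUDELOC for a strengthening.
[cite: Balaban1985UV3, (41) p.266] -/
theorem crudeLocality_of_fluctuationPartSmall (h : FluctuationPartSmall) : CrudeLocalityCan := by
  intro L
  obtain ⟨pS, H⟩ := h L
  refine ⟨pS, fun b₀ p₀ hb hpS hp => ?_⟩
  obtain ⟨ε₁, hε₁, H⟩ := H b₀ p₀ hb hpS hp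
  refine ⟨ε₁, hε₁, fun ε₀ hε₀ hε₀1 => ?_⟩
  obtain ⟨γ₁, hγ₁, κ, hκ, H⟩ := H ε₀ hε₀ hε₀1
  refine ⟨γ₁, hγ₁, κ, hκ, fun F γ hFL hγ hγle => ?_⟩
  obtain ⟨φ, hφ0, hφt, H⟩ := H F γ hFL hγ hγle
  -- a sequence with `J·φ J → 0` is bounded
  have hev : ∀ᶠ J : ℕ in atTop, (J : ℝ) * φ J < 1 := (tendsto_order.1 hφt).2 1 one_pos
  obtain ⟨J₀, hJ₀⟩ := eventually_atTop.1 hev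
  have hsum0 : 0 ≤ ∑ i ∈ Finset.range (J₀ + 1), φ i := Finset.sum_nonneg fun i _ => hφ0 i
  have hbdd : ∀ J, φ J ≤ (∑ i ∈ Finset.range (J₀ + 1), φ i) + 1 := by
    intro J
    rcases le_or_gt J J₀ with hJ | hJ
    · have : φ J ≤ ∑ i ∈ Finset.range (J₀ + 1), φ i :=
        Finset.single_le_sum (fun i _ => hφ0 i) (Finset.mem_range.2 (Nat.lt_succ_of_le hJ))
      linarith
    · have hJ1 : (1 : ℝ) ≤ (J : ℝ) := by exact_mod_cast Nat.succ_le_of_lt (lt_of_le_of_lt (Nat.zero_le _) hJ)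
      have h1 : (J : ℝ) * φ J < 1 := hJ₀ J hJ.le
      have h2 : φ J ≤ (J : ℝ) * φ J := by nlinarith [hφ0 J]
      linarith
  exact ⟨φ, hφ0, ⟨0, (∑ i ∈ Finset.range (J₀ + 1), φ i) + 1, fun J => by simpa using hbdd J⟩, H⟩

/-! ## §2 Three one-line tools: the interpolation `min ≤ √(·,·)`, the oscillation bound on a 4-point, `√(e^{−t}) = e^{−t/2}` -/

/-- `min x y ≤ √(x·y)` for `x, y ≥ 0` — the interpolation that trades half the rate for the geometric mean of the sizes. [folklore] -/
theorem min_le_sqrt_mul {x y : ℝ} (hx : 0 ≤ x) (hy : 0 ≤ y) : min x y ≤ Real.sqrt (x * y) := by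
  rcases le_total x y with h | h
  · rw [min_eq_left h]
    calc x = Real.sqrt (x ^ 2) := (Real.sqrt_sq hx).symm
      _ ≤ Real.sqrt (x * y) := Real.sqrt_le_sqrt (by nlinarith)
  · rw [min_eq_right h]
    calc y = Real.sqrt (y ^ 2) := (Real.sqrt_sq hy).symm
      _ ≤ Real.sqrt (x * y) := Real.sqrt_le_sqrt (by nlinarith)

/-- A function whose values (shifted by a constant) lie in `[0, τ]` at the four corners has connected 4-point `≤ 2τ` in absolute value. [folklore] -/
theorem abs_fourPt_log_sub_le {X : Type*} (ρ g : X → ℝ) (c τ : ℝ) (U V W Z : X)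
    (hU : 0 ≤ Real.log (ρ U) - c - Real.log (g U) ∧ Real.log (ρ U) - c - Real.log (g U) ≤ τ)
    (hV : 0 ≤ Real.log (ρ V) - c - Real.log (g V) ∧ Real.log (ρ V) - c - Real.log (g V) ≤ τ)
    (hW : 0 ≤ Real.log (ρ W) - c - Real.log (g W) ∧ Real.log (ρ W) - c - Real.log (g W) ≤ τ)
    (hZ : 0 ≤ Real.log (ρ Z) - c - Real.log (g Z) ∧ Real.log (ρ Z) - c - Real.log (g Z) ≤ τ) :
    |fourPt (fun U => Real.log (ρ U) - Real.log (g U)) U V W Z| ≤ 2 * τ := by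
  obtain ⟨hU0, hU1⟩ := hU
  obtain ⟨hV0, hV1⟩ := hV
  obtain ⟨hW0, hW1⟩ := hW
  obtain ⟨hZ0, hZ1⟩ := hZ
  simp only [fourPt]
  rw [abs_le]
  constructor <;> linarith

/-- `|A − B| ≤ |A| + |B|`. [folklore] -/
theorem abs_sub_le_abs_add_abs (A B : ℝ) : |A - B| ≤ |A| + |B| := by
  have h := abs_add_le A (-B)
  rwa [abs_neg, ← sub_eq_add_neg] at h

/-- `√(e^{−t}) = e^{−t/2}`. [folklore] -/
theorem sqrt_exp_neg (t : ℝ) : Real.sqrt (Real.exp (-t)) = Real.exp (-(t / 2)) := by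
  have h : Real.exp (-t) = Real.exp (-(t / 2)) ^ 2 := by
    rw [sq, ← Real.exp_add]; ring_nf
  rw [h, Real.sqrt_sq (Real.exp_pos _).le]

/-! ## §3 PROVED: 1L4ᶜ → H4ᶜ → TAILSUP → CRUDELOC → LFR♯ᶜ (the interpolation knit) -/

/-- The implication this line certifies, as ONE named proposition: 1L4ᶜ → H4ᶜ → TAILSUP → CRUDELOC → LFR♯ᶜ (so that `largeFieldFourPtCan_of_stubs` below is the
UNIQUE theorem concluding `LargeFieldFourPtCan` by name — the skeleton audit's candidate rule; this file is PUBLISHED, not registered — RULING №36 (3)). -/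
def SplitSuffices : Prop :=
  OneLoopClusteredCan → BeyondOneLoopSmallCan → WindowOddsSupCan → CrudeLocalityCan → LargeFieldFourPtCan

/-- **COMPOSITION (PROVED)**: `Δ²(log ρ − log q^{hist}) = Δ²(log ρ + β𝔄) − Δ²f¹` (✓`fluctAtCan_one`); LOCALITY: `≤ (C_J + φ₁J + φ₂J)e^{−κ₀d}` by CRUDELOC and
1L4ᶜ(T) + H4ᶜ; SIZE: `≤ 2τ_J` by TAILSUP; KNIT: `min ≤ √`, `ψ J := √(2(C J + φ₁ J + φ₂ J)·τ J)`, `κ := κ₀/2`, and `J·ψ J → 0` from polynomial × super-polynomial.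
[cite: Balaban1985UV3, (41) p.266; Balaban1989LargeFieldII, (1.95) p.389] -/
theorem largeFieldFourPtCan_of_split : SplitSuffices := by
  intro h1 h2 hT hC L
  obtain ⟨pS₁, H1⟩ := h1 L
  obtain ⟨pS₂, H2⟩ := h2 L
  obtain ⟨pS₃, H3⟩ := hT L
  obtain ⟨pS₄, H4⟩ := hC L
  refine ⟨max (max pS₁ pS₂) (max pS₃ pS₄), fun b₀ p₀ hb hpS hp => ?_⟩
  have hp1 : pS₁ ≤ p₀ := ((le_max_left _ _).trans (le_max_left _ _)).trans hpS
  have hp2 : pS₂ ≤ p₀ := ((le_max_right _ _).trans (le_max_left _ _)).trans hpS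
  have hp3 : pS₃ ≤ p₀ := ((le_max_left _ _).trans (le_max_right _ _)).trans hpS
  have hp4 : pS₄ ≤ p₀ := ((le_max_right _ _).trans (le_max_right _ _)).trans hpS
  obtain ⟨ε₁, hε₁, H1⟩ := H1 b₀ p₀ hb hp1 hp
  obtain ⟨ε₂, hε₂, H2⟩ := H2 b₀ p₀ hb hp2 hp
  obtain ⟨γ₃, hγ₃, H3⟩ := H3 b₀ p₀ hb hp3 hp
  obtain ⟨ε₄, hε₄, H4⟩ := H4 b₀ p₀ hb hp4 hp
  -- one common admissible regularisation parameter for the three ε-rows (LFR♯ᶜ itself is ε-free)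
  obtain ⟨ε₀, hε₀def⟩ : ∃ ε₀ : ℝ, ε₀ = min ε₁ (min ε₂ ε₄) := ⟨_, rfl⟩
  have hε₀ : 0 < ε₀ := by rw [hε₀def]; exact lt_min hε₁ (lt_min hε₂ hε₄)
  obtain ⟨γ₁, hγ₁, κ₁, hκ₁, H1⟩ := H1 ε₀ hε₀ (by rw [hε₀def]; exact min_le_left _ _)
  obtain ⟨γ₂, hγ₂, κ₂, hκ₂, H2⟩ := H2 ε₀ hε₀ (by rw [hε₀def]; exact (min_le_right _ _).trans (min_le_left _ _))
  obtain ⟨γ₄, hγ₄, κ₄, hκ₄, H4⟩ := H4 ε₀ hε₀ (by rw [hε₀def]; exact (min_le_right _ _).trans (min_le_right _ _))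
  obtain ⟨κ₀, hκ₀def⟩ : ∃ κ₀ : ℝ, κ₀ = min κ₁ (min κ₂ κ₄) := ⟨_, rfl⟩
  have hκ₀ : 0 < κ₀ := by rw [hκ₀def]; exact lt_min hκ₁ (lt_min hκ₂ hκ₄)
  have hκ₀1 : κ₀ ≤ κ₁ := by rw [hκ₀def]; exact min_le_left _ _
  have hκ₀2 : κ₀ ≤ κ₂ := by rw [hκ₀def]; exact (min_le_right _ _).trans (min_le_left _ _)
  have hκ₀4 : κ₀ ≤ κ₄ := by rw [hκ₀def]; exact (min_le_right _ _).trans (min_le_right _ _)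
  refine ⟨min (min γ₁ γ₂) (min γ₃ γ₄), lt_min (lt_min hγ₁ hγ₂) (lt_min hγ₃ hγ₄), κ₀ / 2, half_pos hκ₀,
    fun F γ hFL hγ hγle => ?_⟩
  obtain ⟨φ₁, hφ₁0, hφ₁t, H1⟩ := H1 F γ hFL hγ (hγle.trans ((min_le_left _ _).trans (min_le_left _ _)))
  obtain ⟨φ₂, hφ₂0, hφ₂t, H2⟩ := H2 F γ hFL hγ (hγle.trans ((min_le_left _ _).trans (min_le_right _ _)))
  obtain ⟨τ, hτ0, hτa, H3⟩ := H3 F γ hFL hγ (hγle.trans ((min_le_right _ _).trans (min_le_left _ _)))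
  obtain ⟨C, hC0, hCpoly, H4⟩ := H4 F γ hFL hγ (hγle.trans ((min_le_right _ _).trans (min_le_right _ _)))
  refine ⟨fun J => Real.sqrt (2 * (C J + φ₁ J + φ₂ J) * τ J), fun J => Real.sqrt_nonneg _, ?_, ?_⟩
  · -- `J·ψ J → 0`: polynomial × super-polynomial
    have hJτ : Tendsto (fun J : ℕ => (J : ℝ) * τ J) atTop (𝓝 0) := by
      have h1 : Tendsto (fun J : ℕ => ((J : ℝ) + 1) ^ 1 * τ J) atTop (𝓝 0) := hτa 1
      refine squeeze_zero (fun J => mul_nonneg (Nat.cast_nonneg J) (hτ0 J)) (fun J => ?_) h1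
      rw [pow_one]
      exact mul_le_mul_of_nonneg_right (by linarith) (hτ0 J)
    have hCτ : Tendsto (fun J : ℕ => (J : ℝ) ^ 2 * (C J * τ J)) atTop (𝓝 0) := by
      obtain ⟨a, C₀, hCle⟩ := hCpoly
      have h2 : Tendsto (fun J : ℕ => C₀ * (((J : ℝ) + 1) ^ (a + 2) * τ J)) atTop (𝓝 0) := by
        have := (hτa (a + 2)).const_mul C₀
        rwa [mul_zero] at this
      refine squeeze_zero (fun J => ?_) (fun J => ?_) h2
      · have := hC0 J; have := hτ0 J; positivity
      · have hJ1 : (J : ℝ) ^ 2 ≤ ((J : ℝ) + 1) ^ 2 := by nlinarith [Nat.cast_nonneg (α := ℝ) J]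
        calc (J : ℝ) ^ 2 * (C J * τ J) ≤ ((J : ℝ) + 1) ^ 2 * (C₀ * ((J : ℝ) + 1) ^ a * τ J) :=
              mul_le_mul hJ1 (mul_le_mul_of_nonneg_right (hCle J) (hτ0 J)) (mul_nonneg (hC0 J) (hτ0 J)) (by positivity)
          _ = C₀ * (((J : ℝ) + 1) ^ (a + 2) * τ J) := by ring
    have hφ₁τ : Tendsto (fun J : ℕ => ((J : ℝ) * φ₁ J) * ((J : ℝ) * τ J)) atTop (𝓝 0) := by
      have := hφ₁t.mul hJτ
      rwa [mul_zero] at this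
    have hφ₂τ : Tendsto (fun J : ℕ => ((J : ℝ) * φ₂ J) * ((J : ℝ) * τ J)) atTop (𝓝 0) := by
      have := hφ₂t.mul hJτ
      rwa [mul_zero] at this
    have hinner : Tendsto (fun J : ℕ => (J : ℝ) ^ 2 * (2 * (C J + φ₁ J + φ₂ J) * τ J)) atTop (𝓝 0) := by
      have h := ((hCτ.add hφ₁τ).add hφ₂τ).const_mul 2
      simp only [add_zero, mul_zero] at h
      refine h.congr' (Eventually.of_forall fun J => ?_)
      ring
    have h := hinner.sqrt
    rw [Real.sqrt_zero] at h
    refine h.congr' (Eventually.of_forall fun J => ?_)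
    show Real.sqrt ((J : ℝ) ^ 2 * (2 * (C J + φ₁ J + φ₂ J) * τ J)) = (J : ℝ) * Real.sqrt (2 * (C J + φ₁ J + φ₂ J) * τ J)
    rw [Real.sqrt_mul (sq_nonneg _), Real.sqrt_sq (Nat.cast_nonneg J)]
  · intro ν hνK hνd J K hJK ρ hρpos hνρ hρcont hgpos b b' U V W Z hU hV hW hZ hUV hUW hVZ hWZ
    obtain ⟨-, -, H1q⟩ := H1 J K hJK
    obtain ⟨-, hΛ⟩ := H1q b b' U V W Z hU hV hW hZ hUV hUW hVZ hWZ
    have hq := H2 J K hJK b b' U V W Z hU hV hW hZ hUV hUW hVZ hWZ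
    obtain ⟨c, hc⟩ := H3 ν hνK hνd J K hJK ρ hρpos hνρ hρcont hgpos
    have hl := H4 ν hνK hνd J K hJK ρ hρpos hνρ hρcont b b' U V W Z hU hV hW hZ hUV hUW hVZ hWZ
    set g : GaugeField (F.P J) 0 (Matrix.specialUnitaryGroup (Fin 2) ℂ) → ℝ :=
      fun U => heightDensityCan F γ hJK (histGood F ℰp (θBal F.L γ b₀ p₀) K J) U with hg
    set B : GaugeField (F.P J) 0 (Matrix.specialUnitaryGroup (Fin 2) ℂ) → ℝ :=
      fun U => (F.scheme ℰp γ).β K * minActionRegPr F J K hJK ε₀ U with hB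
    set Λ : ℝ := oneLoopFourPtCan F γ b₀ p₀ ε₀ hJK U V W Z with hΛdef
    set d : ℝ := (b.src.tdist b'.src : ℝ) with hd
    have hd0 : 0 ≤ d := by rw [hd]; exact Nat.cast_nonneg _
    have hf1 : fourPt (fluctAtCan F γ b₀ p₀ ε₀ hJK 1) U V W Z
        = ((Real.log (g U) + B U) - (Real.log (g V) + B V)) - ((Real.log (g W) + B W) - (Real.log (g Z) + B Z)) := by
      simp only [fourPt, fluctAtCan_one, hg, hB]
    -- the LFR♯ᶜ quantity is the DIFFERENCE of the full and the small-history fluctuation 4-points (never estimated directly)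
    have hsplit : fourPt (fun U => Real.log (ρ U) - Real.log (g U)) U V W Z
        = (((Real.log (ρ U) + B U) - (Real.log (ρ V) + B V)) - ((Real.log (ρ W) + B W) - (Real.log (ρ Z) + B Z)))
          - fourPt (fluctAtCan F γ b₀ p₀ ε₀ hJK 1) U V W Z := by
      rw [hf1]; simp only [fourPt]; ring
    have e1 : Real.exp (-(κ₁ * d)) ≤ Real.exp (-(κ₀ * d)) := Real.exp_le_exp.mpr (neg_le_neg (mul_le_mul_of_nonneg_right hκ₀1 hd0))
    have e2 : Real.exp (-(κ₂ * d)) ≤ Real.exp (-(κ₀ * d)) := Real.exp_le_exp.mpr (neg_le_neg (mul_le_mul_of_nonneg_right hκ₀2 hd0))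
    have e4 : Real.exp (-(κ₄ * d)) ≤ Real.exp (-(κ₀ * d)) := Real.exp_le_exp.mpr (neg_le_neg (mul_le_mul_of_nonneg_right hκ₀4 hd0))
    have hφ₁J := hφ₁0 J
    have hφ₂J := hφ₂0 J
    have hτJ := hτ0 J
    have hCJ := hC0 J
    -- LOCALITY WITHOUT SIZE
    have hx : |fourPt (fun U => Real.log (ρ U) - Real.log (g U)) U V W Z| ≤ (C J + φ₁ J + φ₂ J) * Real.exp (-(κ₀ * d)) := by
      have htri : |fourPt (fluctAtCan F γ b₀ p₀ ε₀ hJK 1) U V W Z| ≤ |Λ| + |fourPt (fluctAtCan F γ b₀ p₀ ε₀ hJK 1) U V W Z - Λ| := by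
        have := abs_add_le Λ (fourPt (fluctAtCan F γ b₀ p₀ ε₀ hJK 1) U V W Z - Λ)
        simpa only [add_sub_cancel] using this
      rw [hsplit]
      refine (abs_sub_le_abs_add_abs _ _).trans ?_
      calc |((Real.log (ρ U) + B U) - (Real.log (ρ V) + B V)) - ((Real.log (ρ W) + B W) - (Real.log (ρ Z) + B Z))|
              + |fourPt (fluctAtCan F γ b₀ p₀ ε₀ hJK 1) U V W Z|
            ≤ C J * Real.exp (-(κ₄ * d)) + (|Λ| + |fourPt (fluctAtCan F γ b₀ p₀ ε₀ hJK 1) U V W Z - Λ|) := add_le_add hl htri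
        _ ≤ C J * Real.exp (-(κ₄ * d)) + (φ₁ J * Real.exp (-(κ₁ * d)) + φ₂ J * Real.exp (-(κ₂ * d))) :=
            add_le_add le_rfl (add_le_add hΛ hq)
        _ ≤ C J * Real.exp (-(κ₀ * d)) + (φ₁ J * Real.exp (-(κ₀ * d)) + φ₂ J * Real.exp (-(κ₀ * d))) := by
            gcongr
        _ = (C J + φ₁ J + φ₂ J) * Real.exp (-(κ₀ * d)) := by ring
    -- SIZE WITHOUT LOCALITY
    have hy : |fourPt (fun U => Real.log (ρ U) - Real.log (g U)) U V W Z| ≤ 2 * τ J :=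
      abs_fourPt_log_sub_le ρ g c (τ J) U V W Z (hc U hU) (hc V hV) (hc W hW) (hc Z hZ)
    -- KNIT: min ≤ geometric mean
    have hx0 : 0 ≤ (C J + φ₁ J + φ₂ J) * Real.exp (-(κ₀ * d)) := by positivity
    have hprod : 0 ≤ 2 * (C J + φ₁ J + φ₂ J) * τ J := by positivity
    show |fourPt (fun U => Real.log (ρ U) - Real.log (g U)) U V W Z|
        ≤ Real.sqrt (2 * (C J + φ₁ J + φ₂ J) * τ J) * Real.exp (-(κ₀ / 2 * d))
    calc |fourPt (fun U => Real.log (ρ U) - Real.log (g U)) U V W Z|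
          ≤ min ((C J + φ₁ J + φ₂ J) * Real.exp (-(κ₀ * d))) (2 * τ J) := le_min hx hy
      _ ≤ Real.sqrt (((C J + φ₁ J + φ₂ J) * Real.exp (-(κ₀ * d))) * (2 * τ J)) := min_le_sqrt_mul hx0 (by positivity)
      _ = Real.sqrt ((2 * (C J + φ₁ J + φ₂ J) * τ J) * Real.exp (-(κ₀ * d))) := by congr 1; ring
      _ = Real.sqrt (2 * (C J + φ₁ J + φ₂ J) * τ J) * Real.sqrt (Real.exp (-(κ₀ * d))) := Real.sqrt_mul hprod _
      _ = Real.sqrt (2 * (C J + φ₁ J + φ₂ J) * τ J) * Real.exp (-(κ₀ / 2 * d)) := by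
          rw [sqrt_exp_neg, show -(κ₀ * d / 2) = -(κ₀ / 2 * d) by ring]

end Rows

/-! ## §4 Stubs (the rows' sorries) and the LFR♯ᶜ this file delivers -/

section Stubs

/-- 1L4ᶜ — SHARED organ of LINE g18-1 (there ✓`oneLoopClusteredCan_of_organs` modulo EXW `stub_windowExactness`, GAP♯ `stub_uniformFibreGapOrbit`, DET-REP-B
`stub_detRepB`); restated by TEXT, byte-identical; not a row of this line's own. [cite: Balaban1985Variational, Thm 1 (8)-(10) p.279] -/
theorem stub_oneLoopClusteredCan : OneLoopClusteredCan := by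
  sorry

/-- H4ᶜ — SHARED organ of LINE g18-1 (hands: REP `Lines/loop_ledger.lean` v6; DIFF ✓p752011 + FMIX `Lines/virial_flow.lean` v1.2); byte-identical text.
[cite: Balaban1985UV3, (45)-(47) p.267] -/
theorem stub_beyondOneLoopSmallCan : BeyondOneLoopSmallCan := by
  sorry

/-- TAILSUP — NEW (size L): fibrewise history odds, sup-norm, super-polynomial modulus. [cite: Balaban1989LargeFieldII, (1.77)-(1.79) p.383] -/
theorem stub_windowOddsSupCan : WindowOddsSupCan := by
  sorry

/-- CRUDELOC — NEW (size XL; this line's organ): quasi-locality of the full fluctuation part with polynomial response modulus.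
[cite: Balaban1989LargeFieldII, (1.66)-(1.67) p.376; Balaban1988Convergent, §2 (2.18)-(2.27)] -/
theorem stub_crudeLocalityCan : CrudeLocalityCan := by
  sorry

/-- TAILSUP₁ for the hands, from the TAILSUP stub. -/
theorem stub_windowOddsSupDepthOneCan : WindowOddsSupDepthOneCan := windowOddsSupDepthOne_of stub_windowOddsSupCan

/-- **THE LFR♯ᶜ THIS FILE DELIVERS** (modulo its four sorries: two SHARED organs of LINE g18-1 and the two NEW rows). -/
theorem largeFieldFourPtCan_of_stubs : LargeFieldFourPtCan :=
  largeFieldFourPtCan_of_split stub_oneLoopClusteredCan stub_beyondOneLoopSmallCan stub_windowOddsSupCan stub_crudeLocalityCan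

end Stubs

end Summit.QuantumFields.YangMills.Cruxes.FluctuationComparisonRegPrIntL.RunPairOrgan.SupTailSplit
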